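import Summits.QuantumFields.YangMills.Theorems.BalabanUVNodesN19LipschitzLinkTrigSmoothing
import Summits.QuantumFields.YangMills.Theorems.BalabanUVNodesN19SmoothLinkFirstOrder
import Summits.QuantumFields.YangMills.Theorems.BalabanUVNodesN19SingleModeLogFree
import Summits.QuantumFields.YangMills.Theorems.BalabanUVNodesN19OscillatingLinksMultiscale

/-!
# YM-DAG node N19 (= NE7 proper) — EVERY LIPSCHITZ LINK OF THE ℓ¹-NORM AT THE RIDGE RATE UP TO `log³`
# (`dist_∞(h∘S_d, Π_t) ≤ 10⁴·K·d·log₂³t∕t` for every `K`-Lipschitz `h` on `[0, d]`, all `d`, all `t ≥ 2` — (v′) of CURRENCY-MAP v11 settled up to logarithms)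

Cell `pub-ymgap`, HUMAN RULING D-0062 (Track A) ∕ D-0149 (work-bound push), R141 (C) wider-strategy seat `pub-ymgap-dag-n19-e` (strategy
s3 = ALTERNATIVE CURRENCY), generation g33, module 5 (lineage module 152b).  Route `Summits/QuantumFields/YangMills/Theses/BalabanUVNodes.lean`,
cluster item K3⁸ «SpineGivenEndpointR13SepCoPHV» (stmt-QuantumFields-27366); filed `--supports` that item `--as helper` (it proves no registered
stub).  COUNT-NEUTRAL: [folklore]∕[bookkeeping] approximation theory over Mathlib and, BY NAME, the lineage's modules 152a
`…N19LipschitzLinkTrigSmoothing` (`exists_trigLink_near_lipschitzLink`: the Fejér–Steklov smoothing of the link, priced by `K`), 151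
`…N19SmoothLinkFirstOrder` (`exists_mvPolynomial_near_trigLink_firstOrder`: the smoothed-link first-order law) and 140 `…N19SingleModeLogFree`
(`exists_scale`, `exists_order`, `nine_le_logb`: the ladder parameters at budget `t`); no laws, no scheme object, no Theses import; NOT a discharge claim.

THE RESULT.  In the degree model (`S_d = Σ_{i≤d}|x_i|` on `[−1,1]^d`, `Π_t` = real polynomials of total degree `≤ t`) the lineage had, for the class
of ALL Lipschitz links, `d∕(π(9t+6)) ≤ sup_{h 1-Lip} dist_∞(h∘S_d, Π_t) ≲ d∕√t` (module 134 ∕ module 111's nesting `q(Σ_i p(x_i))`), conjectured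
`Θ(d∕t)` on numerical evidence (g28: certified LPs, `k ≤ 8`, `t ≤ 32`: ridge-like), every structured sub-class (ridge, single modes, trigonometric
and `C²` links, zigzags, hinges, absolutely monotone links) at `d∕t` up to `log²t`, and the general class blocked at `d∕√t` («links with many small
kinks»; OPEN-PROBLEM.md dead end «Fourier synthesis loses `√`: `Σ_{n≤t}|ĥ′(n)| ≍ √t`»).  THIS MODULE: ★★★ `exists_mvPolynomial_near_lipschitzLink_l1Norm`
— **for every finite nonempty `ι` (`d = |ι|`), every `K ≥ 0`, every `h` with `|h(s) − h(s′)| ≤ K|s − s′|` on `[0, d]` and every `t ≥ 2` there is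
`P : MvPolynomial ι ℝ` of total degree `≤ t` with `|h(Σ_i|x_i|) − P(x)| ≤ 10⁴·K·d·(log₂t)³∕t` on `[−1,1]^ι`** — the general class at the ridge rate
up to `log³t` (constant astronomical, nowhere optimised: one `log` is the Fejér kernel's, two are the ladder budget's `h·2^J ≲ t`).
THE MECHANISM (modules 150–152a): smooth `h` at scale `d∕L` by Fejér–Steklov (a trigonometric `g` with `|g′| ≤ K`, `g′` `(KπL∕d)`-Lipschitz,
`|h − g| ≤ Kd(1∕π + 1 + log L)∕L` — priced by `K`, not by coefficients), write `g(S) = g(A_J) + g′(A_J)(A_N − A_J) + O(KπL∕d·(dπ∕2^J)² + K·dπ∕N)`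
(module 139's first-order step with `g` in place of the character) and realise `g(A_J)`, `g′(A_J)` through the character ladders (ONE `A_J` for
all `L²` modes; the ℓ¹ mass `2LKd` multiplies only `e^{−h} ≤ t^{−3}`); budget: `L = ⌊t∕(6912 log₂²t)⌋`, `4^J ≍ Lπ³t`, `h = ⌈3 log t⌉`, `N = ⌊3t∕8⌋`.
§1 `logb_sq_le` (`log₂²t ≤ t∕20736` for `t ≥ 2^24`), `exists_parameters`; §2 ★★★ `exists_mvPolynomial_near_lipschitzLink_l1Norm_of_le` (`t ≥ 2^24`,
constant `8000`) and ★★★ `exists_mvPolynomial_near_lipschitzLink_l1Norm` (all `t ≥ 2`, constant `10⁴`; below `2^24` the constant `h(0)` suffices).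
The two-sided row and the law-level (`W₁`) face are in the sequel `…N19LipschitzLinksTwoSided`.

HONEST FRAMING (binding).  Elementary and [folklore]; ONE-SIDED (upper bound; module 134's `d∕(π(9t+6))` is the lower side); NO consumer in the DAG
today (an optimality map of the seat's own currency, degree model); nothing of Bałaban's instantiated; NE7 NOT PRINTED, NOT proved; N19 NOT
discharged; count-neutral.  One finite `T⁴` programme at fixed `ε`; nothing continuum ∕ `ℝ⁴` ∕ OS ∕ mass-gap ∕ Clay.  0 `def` ∕ 0 `sorry`.
-/

noncomputable section

open Finset
open scoped Real

namespace Summit.QuantumFields.YangMills.Theorems.BalabanUVNodesN19LipschitzLinksDegreeBudget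

open Summit.QuantumFields.YangMills.Theorems.BalabanUVNodesN19LipschitzLinkTrigSmoothing (exists_trigLink_near_lipschitzLink)
open Summit.QuantumFields.YangMills.Theorems.BalabanUVNodesN19SmoothLinkFirstOrder (exists_mvPolynomial_near_trigLink_firstOrder)
open Summit.QuantumFields.YangMills.Theorems.BalabanUVNodesN19SingleModeLogFree (exists_scale exists_order nine_le_logb)
open Summit.QuantumFields.YangMills.Theorems.BalabanUVNodesN19OscillatingLinksMultiscale (l1Norm_mem_Icc)

variable {ι : Type*} [Fintype ι]

/-! ## §1 The parameters at budget `t` [bookkeeping] -/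

/-- `log₂t ≥ 24` and `log₂²t ≤ t∕20736` for `t ≥ 2^24` (`u ↦ 2^u∕u²` beyond `u = 24`: `(1 + v∕24)² ≤ e^{v∕12} ≤ 2^v`). [bookkeeping] -/
theorem logb_sq_le {t : ℕ} (ht : 2 ^ 24 ≤ t) : 24 ≤ Real.logb 2 t ∧ 20736 * Real.logb 2 t ^ 2 ≤ t := by
  set u : ℝ := Real.logb 2 t with hu
  have ht0 : (0 : ℝ) < t := by exact_mod_cast (show 0 < t by omega)
  have htr : (2 : ℝ) ^ (24 : ℝ) ≤ t := by
    have : ((2 ^ 24 : ℕ) : ℝ) ≤ t := by exact_mod_cast ht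
    rw [show (24 : ℝ) = ((24 : ℕ) : ℝ) by norm_num, Real.rpow_natCast]; exact_mod_cast this
  have hu24 : 24 ≤ u := by rw [hu, Real.le_logb_iff_rpow_le one_lt_two ht0]; exact htr
  refine ⟨hu24, ?_⟩
  have htu : (t : ℝ) = 2 ^ u := by rw [hu, Real.rpow_logb two_pos (by norm_num) ht0]
  set v : ℝ := u - 24 with hv
  have hv0 : 0 ≤ v := by linarith
  have h2u : (2 : ℝ) ^ u = 2 ^ (24 : ℝ) * 2 ^ v := by rw [← Real.rpow_add two_pos]; congr 1; ring
  have h24 : (2 : ℝ) ^ (24 : ℝ) = 16777216 := by rw [show (24 : ℝ) = ((24 : ℕ) : ℝ) by norm_num, Real.rpow_natCast]; norm_num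
  -- `(1 + v/24)² ≤ exp(v/12) ≤ 2^v`
  have h1 : (1 + v / 24) ^ 2 ≤ Real.exp (v / 12) := by
    have h := Real.add_one_le_exp (v / 24)
    have h0 : 0 ≤ 1 + v / 24 := by linarith
    calc (1 + v / 24) ^ 2 ≤ Real.exp (v / 24) ^ 2 := pow_le_pow_left₀ h0 (by linarith) 2
      _ = Real.exp (v / 12) := by rw [← Real.exp_nat_mul]; congr 1; push_cast; ring
  have h2 : Real.exp (v / 12) ≤ (2 : ℝ) ^ v := by
    rw [Real.rpow_def_of_pos two_pos, Real.exp_le_exp]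
    have := Real.log_two_gt_d9
    nlinarith
  have husq : u ^ 2 = 576 * (1 + v / 24) ^ 2 := by rw [hv]; ring
  calc 20736 * u ^ 2 = 11943936 * (1 + v / 24) ^ 2 := by rw [husq]; ring
    _ ≤ 11943936 * (2 : ℝ) ^ v := by nlinarith [h1.trans h2]
    _ ≤ 16777216 * (2 : ℝ) ^ v := by nlinarith [Real.rpow_nonneg (by norm_num : (0 : ℝ) ≤ 2) v]
    _ = t := by rw [htu, h2u, h24]

/-- **THE PARAMETERS AT BUDGET `t ≥ 2^24`.**  With `Λ = log₂t`: a Fejér order `L ≥ 1` with `t ≤ 10368Λ²·L` and `6912Λ²·L ≤ t`; a scale `J`,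
a Taylor order `h ≥ 1` and a Jackson order `N` with `(J+1)e^{−h} ≤ ½`, `e^{−h} ≤ t^{−3}`, `J + 1 ≤ t∕4`, `Lπ·π ≤ 2^J ≤ N`, `(Lπ²∕2^J)² ≤ 64Lπ∕t`,
`t∕4 ≤ N`, and the degree budget `2e²(Lπ)(½ + π + 3πJ) + 2h(2^{J+1} − 1) + 2N ≤ t` (module 140's `exists_scale` ∕ `exists_order` with `a = Lπ`,
`aΛ² ≤ t∕2048` because `6912 ≥ 2048π`; `N = ⌊3t∕8⌋`). [bookkeeping] -/
theorem exists_parameters {t : ℕ} (ht : 2 ^ 24 ≤ t) :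
    ∃ L J h N : ℕ, 1 ≤ L ∧ (t : ℝ) ≤ 10368 * Real.logb 2 t ^ 2 * L ∧ 6912 * Real.logb 2 t ^ 2 * L ≤ t ∧
      1 ≤ h ∧ ((J : ℝ) + 1) * Real.exp (-(h : ℝ)) ≤ 1 / 2 ∧ Real.exp (-(h : ℝ)) ≤ 1 / (t : ℝ) ^ 3 ∧ (J : ℝ) + 1 ≤ t / 4 ∧
      (L : ℝ) * π * π ≤ 2 ^ J ∧ 2 ^ J ≤ N ∧ ((L : ℝ) * π * π / 2 ^ J) ^ 2 ≤ 64 * (L * π) / t ∧ (t : ℝ) / 4 ≤ N ∧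
      2 * Real.exp 2 * (L * π) * (1 / 2 + π + 3 * π * J) + 2 * h * (2 ^ (J + 1) - 1) + 2 * N ≤ t := by
  obtain ⟨hΛ24, hΛsq⟩ := logb_sq_le ht
  set Λ : ℝ := Real.logb 2 t with hΛ
  have ht512 : 512 ≤ t := le_trans (by norm_num) ht
  have ht0 : (0 : ℝ) < t := by exact_mod_cast (show 0 < t by omega)
  have htr : (16777216 : ℝ) ≤ t := by exact_mod_cast ht
  have hπlo : 3.14 < π := Real.pi_gt_d2
  have hπhi : π < 3.15 := Real.pi_lt_d2
  have hΛ2 : 0 < Λ ^ 2 := by positivity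
  -- the Fejér order
  set x : ℝ := t / (6912 * Λ ^ 2) with hx
  have hx2 : 3 ≤ x := by rw [hx, le_div_iff₀ (by positivity)]; linarith only [hΛsq]
  set L : ℕ := ⌊x⌋₊ with hL
  have hLx : (L : ℝ) ≤ x := Nat.floor_le (by linarith)
  have hxL : x < L + 1 := Nat.lt_floor_add_one x
  have hL1 : 1 ≤ L := by
    have : (1 : ℝ) < (L : ℝ) + 1 - 1 + 1 := by linarith
    have h2 : (0 : ℝ) < L := by linarith
    exact_mod_cast (show 0 < L by exact_mod_cast h2)
  have hLr : (1 : ℝ) ≤ L := by exact_mod_cast hL1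
  have hP2 : (t : ℝ) ≤ 10368 * Λ ^ 2 * L := by
    -- `2x/3 ≤ x − 1 < L` since `x ≥ 3`, and `t = 6912Λ²x`
    have htx : (t : ℝ) = 6912 * Λ ^ 2 * x := by rw [hx]; field_simp
    have hL23 : 2 * x / 3 ≤ L := by linarith only [hx2, hxL]
    rw [htx]
    have := mul_le_mul_of_nonneg_left hL23 (by positivity : (0 : ℝ) ≤ 10368 * Λ ^ 2)
    linarith only [this]
  have hP3 : 6912 * Λ ^ 2 * (L : ℝ) ≤ t := by
    have := mul_le_mul_of_nonneg_left hLx (by positivity : (0 : ℝ) ≤ 6912 * Λ ^ 2)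
    rw [hx, mul_div_cancel₀ _ (by positivity)] at this
    exact this
  -- module 140's scale and order with `a = Lπ`
  set a : ℝ := L * π with ha
  have ha0 : 0 ≤ a := by positivity
  have hreg : a * Λ ^ 2 ≤ t / 2048 := by
    have h1 : a * Λ ^ 2 ≤ 3.15 * (Λ ^ 2 * L) := by
      rw [ha, show (L : ℝ) * π * Λ ^ 2 = π * (Λ ^ 2 * L) by ring]
      exact mul_le_mul_of_nonneg_right hπhi.le (by positivity)
    linarith only [h1, hP3]
  have hbig : 64 < π ^ 2 * a * t := by
    have h1 : (1 : ℝ) ≤ a := by rw [ha]; nlinarith only [hLr, hπlo]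
    have h2 : 9 ≤ π ^ 2 := by nlinarith only [hπlo, Real.pi_pos]
    have h3 : (9 : ℝ) * 1 * 16777216 ≤ π ^ 2 * a * t :=
      mul_le_mul (mul_le_mul h2 h1 zero_le_one (by positivity)) htr (by positivity) (by positivity)
    linarith only [h3]
  obtain ⟨J, hJ4, hJa, hJsq, hMlt⟩ := exists_scale ht512 ha0 hreg hbig
  obtain ⟨h, hh1, hhle, hexph⟩ := exists_order ht512
  have hM0 : (0 : ℝ) < 2 ^ J := by positivity
  have hJ12J : (J : ℝ) + 1 ≤ 2 ^ J := by exact_mod_cast (Nat.lt_two_pow_self : J + 1 ≤ 2 ^ J)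
  have hJ1 : (J : ℝ) + 1 ≤ t / 4 := hJ12J.trans hJ4
  have hP5 : ((J : ℝ) + 1) * Real.exp (-(h : ℝ)) ≤ 1 / 2 := by
    calc ((J : ℝ) + 1) * Real.exp (-(h : ℝ)) ≤ (t / 4) * (1 / t ^ 3) := mul_le_mul hJ1 hexph (Real.exp_pos _).le (by positivity)
      _ = 1 / (4 * t ^ 2) := by field_simp
      _ ≤ 1 / 2 := by rw [div_le_div_iff₀ (by positivity) (by norm_num : (0 : ℝ) < 2)]; nlinarith only [htr]
  -- the Jackson order `N = ⌊3t/8⌋`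
  set N : ℕ := 3 * t / 8 with hN
  have hN4 : (t : ℝ) / 4 ≤ N := by
    have h1 : ((3 * t : ℕ) : ℝ) ≤ ((8 * N + 7 : ℕ) : ℝ) := by exact_mod_cast (show 3 * t ≤ 8 * N + 7 by omega)
    push_cast at h1
    linarith only [h1, htr]
  have h2Nr : (2 * N : ℝ) ≤ 3 * t / 4 := by
    have h1 : ((8 * N : ℕ) : ℝ) ≤ ((3 * t : ℕ) : ℝ) := by exact_mod_cast (show 8 * N ≤ 3 * t by omega)
    push_cast at h1
    linarith only [h1]
  have hNJ : 2 ^ J ≤ N := by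
    have h1 : ((2 ^ J : ℕ) : ℝ) ≤ (N : ℝ) := by push_cast; linarith only [hJ4, hN4]
    exact_mod_cast h1
  -- the ladder's degree (module 140's bookkeeping, `a = Lπ`)
  have hL9 : 9 ≤ Λ := by linarith only [hΛ24]
  have he2 : Real.exp 2 ≤ 7.4 := by
    have he1 : Real.exp 1 ≤ 2.7182818286 := Real.exp_one_lt_d9.le
    have he0 : 0 < Real.exp 1 := Real.exp_pos 1
    have : Real.exp 2 = Real.exp 1 * Real.exp 1 := by rw [← Real.exp_add]; norm_num
    rw [this]; nlinarith only [he1, he0]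
  have hJ1L : (J : ℝ) + 1 ≤ Λ := by
    have h2J1 : (2 : ℝ) ^ (J + 1) ≤ t := by rw [pow_succ]; linarith only [hJ4]
    rw [hΛ, Real.le_logb_iff_rpow_le one_lt_two ht0]
    have e : (2 : ℝ) ^ ((J : ℝ) + 1) = 2 ^ (J + 1) := by rw [← Real.rpow_natCast]; push_cast; ring_nf
    rw [e]; exact h2J1
  have hJ0 : (0 : ℝ) ≤ J := Nat.cast_nonneg _
  have haL1 : a * Λ ≤ t / 18432 := by
    have h1 : a * Λ * 9 ≤ a * Λ * Λ := mul_le_mul_of_nonneg_left hL9 (mul_nonneg ha0 (by linarith only [hL9]))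
    nlinarith only [h1, hreg]
  have hterm1 : 2 * Real.exp 2 * a * (1 / 2 + π + 3 * π * J) ≤ t / 100 := by
    have hX0 : (0 : ℝ) ≤ 1 / 2 + π + 3 * π * J := by positivity
    have s1 : 2 * Real.exp 2 * a * (1 / 2 + π + 3 * π * J) ≤ 14.8 * (a * (1 / 2 + π + 3 * π * J)) := by
      nlinarith only [mul_nonneg (sub_nonneg.2 he2) (mul_nonneg ha0 hX0)]
    have s2 : 1 / 2 + π + 3 * π * (J : ℝ) ≤ 3.65 + 9.45 * Λ := by
      nlinarith only [mul_nonneg (sub_nonneg.2 hπhi.le) hJ0, hπhi, hJ1L]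
    have s3 : a * (1 / 2 + π + 3 * π * J) ≤ a * (3.65 + 9.45 * Λ) := mul_le_mul_of_nonneg_left s2 ha0
    have s4 : a * (3.65 + 9.45 * Λ) ≤ 9.86 * (a * Λ) := by
      nlinarith only [mul_nonneg ha0 (by linarith only [hL9] : (0 : ℝ) ≤ Λ - 9), ha0]
    nlinarith only [s1, s3, s4, haL1, ht0]
  have hterm2 : 2 * (h : ℝ) * (2 ^ (J + 1) - 1) ≤ 4 * t / 25 := by
    have hh0 : (0 : ℝ) ≤ h := Nat.cast_nonneg _
    have s1 : 2 * (h : ℝ) * (2 ^ (J + 1) - 1) ≤ 4 * h * 2 ^ J := by rw [pow_succ]; nlinarith only [hM0, hh0]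
    have s2 : 4 * (h : ℝ) * 2 ^ J ≤ 8.8 * (Λ * 2 ^ J) := by nlinarith only [hhle, hM0]
    have s3 : Λ * 2 ^ J * 181 < π * t := by linarith only [hMlt]
    nlinarith only [s1, s2, s3, hπhi, ht0]
  refine ⟨L, J, h, N, hL1, hP2, hP3, hh1, hP5, hexph, hJ1, ?_, hNJ, ?_, hN4, ?_⟩
  · rw [ha] at hJa; simpa [mul_assoc] using hJa
  · have e : (L : ℝ) * π * π / 2 ^ J = a * π / 2 ^ J := by rw [ha]
    rw [e]; simpa [ha] using hJsq
  · linarith only [hterm1, hterm2, h2Nr, ht0]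

/-! ## §2 ★★★ Every Lipschitz link at the ridge rate up to `log³` [folklore] -/

/-- THE ERROR BOOKKEEPING.  With the parameters of §1 (`M = 2^J`, `ε = 2(J+1)e^{−h} ≤ 1∕(2t²)`, `lg = log L ≤ 0.6932Λ`): smoothing
`Kd(1∕π + 1 + lg)∕L ≤ 7776KdΛ³∕t`, second order `KπL∕d·(dπ∕M)² ≤ 64Kd∕t`, first order `K·dπ∕N ≤ 4πKd∕t`, ladder `ε·2LKd·3 ≤ 3Kd∕t`; total
`≤ 8000KdΛ³∕t`. [bookkeeping] -/
theorem errorBound {K d t Λ L M N ε lg : ℝ} (hK : 0 ≤ K) (hd : 0 < d) (ht : 16777216 ≤ t) (hΛ : 24 ≤ Λ) (hL1 : 1 ≤ L)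
    (hLt : L ≤ t) (htL : t ≤ 10368 * Λ ^ 2 * L) (hlg : lg ≤ 0.6932 * Λ) (hM : L * π * π ≤ M) (hMN : M ≤ N)
    (hJsq : (L * π * π / M) ^ 2 ≤ 64 * (L * π) / t) (hN4 : t / 4 ≤ N) (hε : ε ≤ 1 / (2 * t ^ 2)) :
    K * d * (1 / π + 1 + lg) / L +
      (K * π * L / d * (d * π / M) ^ 2 + K * (d * π / N) + ε * (2 * L * (K * d)) * (1 + L * π / d * (d * π / M + d * π / N))) ≤
        8000 * K * d * Λ ^ 3 / t := by
  have hπlo : 3.14 < π := Real.pi_gt_d2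
  have hπhi : π < 3.15 := Real.pi_lt_d2
  have hπ := Real.pi_pos
  have ht0 : 0 < t := by linarith
  have hL0 : 0 < L := by linarith
  have hM0 : 0 < M := lt_of_lt_of_le (by positivity) hM
  have hN0 : 0 < N := lt_of_lt_of_le hM0 hMN
  have hKd : 0 ≤ K * d := mul_nonneg hK hd.le
  have hΛ0 : 0 < Λ := by linarith
  -- smoothing
  have hT1 : K * d * (1 / π + 1 + lg) / L ≤ 7776 * K * d * Λ ^ 3 / t := by
    have h1 : 1 / π ≤ 0.3185 := by rw [div_le_iff₀ hπ]; nlinarith only [hπlo]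
    have h2 : 1 / π + 1 + lg ≤ 0.75 * Λ := by linarith only [h1, hlg, hΛ]
    have h3 : K * d * (1 / π + 1 + lg) / L ≤ K * d * (0.75 * Λ) / L :=
      div_le_div_of_nonneg_right (mul_le_mul_of_nonneg_left h2 hKd) hL0.le
    refine h3.trans ?_
    rw [div_le_div_iff₀ hL0 ht0]
    have h4 := mul_le_mul_of_nonneg_left htL (by positivity : (0 : ℝ) ≤ K * d * (0.75 * Λ))
    nlinarith only [h4]
  -- second order
  have hT2 : K * π * L / d * (d * π / M) ^ 2 ≤ 64 * K * d / t := by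
    have e : K * π * L / d * (d * π / M) ^ 2 = K * d * (π ^ 3 * L / M ^ 2) := by field_simp
    have h1 : π ^ 3 * L / M ^ 2 ≤ 64 / t := by
      have h2 : (L * π * π / M) ^ 2 = (L * π) * (π ^ 3 * L / M ^ 2) := by field_simp
      have h3 : (L * π) * (π ^ 3 * L / M ^ 2) ≤ (L * π) * (64 / t) := by
        calc (L * π) * (π ^ 3 * L / M ^ 2) = (L * π * π / M) ^ 2 := h2.symm
          _ ≤ 64 * (L * π) / t := hJsq
          _ = (L * π) * (64 / t) := by ring
      exact le_of_mul_le_mul_left h3 (by positivity)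
    rw [e]
    calc K * d * (π ^ 3 * L / M ^ 2) ≤ K * d * (64 / t) := mul_le_mul_of_nonneg_left h1 hKd
      _ = 64 * K * d / t := by ring
  -- first order
  have hT3 : K * (d * π / N) ≤ 13 * K * d / t := by
    have h1 : d * π / N ≤ 13 * d / t := by
      rw [div_le_div_iff₀ hN0 ht0]
      have e1 : d * π * t ≤ 3.15 * (d * t) := by
        rw [show d * π * t = π * (d * t) by ring]
        exact mul_le_mul_of_nonneg_right hπhi.le (by positivity)
      have e2 := mul_le_mul_of_nonneg_left hN4 (by positivity : (0 : ℝ) ≤ 13 * d)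
      have e3 : 0 ≤ d * t := by positivity
      linarith only [e1, e2, e3]
    calc K * (d * π / N) ≤ K * (13 * d / t) := mul_le_mul_of_nonneg_left h1 hK
      _ = 13 * K * d / t := by ring
  -- ladder
  have hT4 : ε * (2 * L * (K * d)) * (1 + L * π / d * (d * π / M + d * π / N)) ≤ 3 * K * d / t := by
    have h1 : L * π / d * (d * π / M) ≤ 1 := by
      rw [show L * π / d * (d * π / M) = L * π * π / M by field_simp, div_le_one hM0]; exact hM
    have h2 : L * π / d * (d * π / N) ≤ 1 := by
      rw [show L * π / d * (d * π / N) = L * π * π / N by field_simp, div_le_one hN0]; exact hM.trans hMN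
    have h3 : 1 + L * π / d * (d * π / M + d * π / N) ≤ 3 := by rw [mul_add]; linarith only [h1, h2]
    have h4 : ε * (2 * L * (K * d)) * (1 + L * π / d * (d * π / M + d * π / N)) ≤ (1 / (2 * t ^ 2)) * (2 * L * (K * d)) * 3 :=
      mul_le_mul (mul_le_mul_of_nonneg_right hε (by positivity)) h3 (by positivity) (by positivity)
    refine h4.trans ?_
    rw [show 1 / (2 * t ^ 2) * (2 * L * (K * d)) * 3 = 3 * K * d * L / t ^ 2 by field_simp,
      div_le_div_iff₀ (by positivity) ht0]
    have := mul_le_mul_of_nonneg_left hLt (by positivity : (0 : ℝ) ≤ 3 * K * d * t)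
    nlinarith only [this]
  -- total
  have hΛ3 : 80 ≤ Λ ^ 3 := by
    have := pow_le_pow_left₀ (by norm_num) hΛ 3
    linarith only [this]
  have hsum : 7776 * K * d * Λ ^ 3 / t + (64 * K * d / t + 13 * K * d / t + 3 * K * d / t) ≤ 8000 * K * d * Λ ^ 3 / t := by
    rw [← add_div, ← add_div, ← add_div]
    refine div_le_div_of_nonneg_right ?_ ht0.le
    nlinarith only [hΛ3, hKd]
  linarith only [hT1, hT2, hT3, hT4, hsum]

variable [Nonempty ι]

/-- ★★★ **EVERY LIPSCHITZ LINK OF THE ℓ¹-NORM AT THE RIDGE RATE UP TO `log³` (budget `t ≥ 2^24`).**  For finite nonempty `ι` (`d = |ι|`), `K ≥ 0`,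
`h : ℝ → ℝ` with `|h(s) − h(s′)| ≤ K|s − s′|` on `[0, d]` and `t ≥ 2^24` there is `P : MvPolynomial ι ℝ` of total degree `≤ t` with
`|h(Σ_i|x_i|) − P(x)| ≤ 8000·K·d·(log₂t)³∕t` on `[−1,1]^ι`.  PROOF: §1's parameters, module 152a's smoothing `g` (`B₂ = KπL∕d`, `B₁ = K`, `W = 2LKd`,
`Ω = Lπ∕d`, `|h − g| ≤ Kd(1∕π + 1 + log L)∕L` on `[0, d]`), module 151's law, and the bookkeeping above. [folklore] -/
theorem exists_mvPolynomial_near_lipschitzLink_l1Norm_of_le {h : ℝ → ℝ} {K : ℝ} (hK0 : 0 ≤ K)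
    (hK : ∀ s s', s ∈ Set.Icc (0 : ℝ) (Fintype.card ι) → s' ∈ Set.Icc (0 : ℝ) (Fintype.card ι) → |h s - h s'| ≤ K * |s - s'|)
    {t : ℕ} (ht : 2 ^ 24 ≤ t) :
    ∃ P : MvPolynomial ι ℝ, P.totalDegree ≤ t ∧
      ∀ x : ι → ℝ, (∀ i, x i ∈ Set.Icc (-1 : ℝ) 1) →
        |h (∑ i, |x i|) - MvPolynomial.eval x P| ≤ 8000 * K * Fintype.card ι * Real.logb 2 t ^ 3 / t := by
  set d : ℝ := (Fintype.card ι : ℝ) with hdd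
  have hd : 0 < d := by rw [hdd]; exact_mod_cast Fintype.card_pos
  have ht0 : (0 : ℝ) < t := by exact_mod_cast (show 0 < t by omega)
  have htr : (16777216 : ℝ) ≤ t := by exact_mod_cast ht
  obtain ⟨hΛ24, hΛsq⟩ := logb_sq_le ht
  obtain ⟨L, J, hh, N, hL1, htL, hLt, hh1, hJh, hexph, hJ1, hLππ, hNJ, hJsq, hN4, hdeg⟩ := exists_parameters ht
  have hLr : (1 : ℝ) ≤ L := by exact_mod_cast hL1
  obtain ⟨α, β, ω, g, g₁, hω0, hωΩ, hW, hg, hg₁, hC11, hB1, herr⟩ := exists_trigLink_near_lipschitzLink hd hK0 hK hL1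
  have hΩ : (0 : ℝ) ≤ L * π / d := by positivity
  obtain ⟨P, hPdeg, hPerr⟩ := exists_mvPolynomial_near_trigLink_firstOrder (ι := ι) (range L ×ˢ range L) (h 0) α β ω
    (Ω := L * π / d) (W := 2 * L * (K * d)) (B₁ := K) (B₂ := K * π * L / d) hg hg₁ hΩ hω0 hωΩ hW hC11 hB1 J hh N hh1 hJh hNJ
  refine ⟨P, ?_, fun x hx => ?_⟩
  · have e : 2 * Real.exp 2 * (L * π / d) * (Fintype.card ι : ℝ) * (1 / 2 + π + 3 * π * J) =
        2 * Real.exp 2 * (L * π) * (1 / 2 + π + 3 * π * J) := by rw [← hdd]; field_simp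
    rw [e] at hPdeg
    exact Nat.cast_le.1 (hPdeg.trans hdeg)
  · have hS := l1Norm_mem_Icc x hx
    rw [← hdd] at hS hPerr
    have h1 := herr (∑ i, |x i|) ⟨hS.1, hS.2⟩
    have h2 := hPerr x hx
    -- the arithmetic
    have hLt' : (L : ℝ) ≤ t := by
      have h1 : (1 : ℝ) ≤ 6912 * Real.logb 2 t ^ 2 := by nlinarith only [hΛ24]
      exact (le_mul_of_one_le_left (by positivity) h1).trans hLt
    have hlg : Real.log L ≤ 0.6932 * Real.logb 2 t := by
      have hlogt : Real.log t = Real.logb 2 t * Real.log 2 := by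
        rw [Real.logb, div_mul_cancel₀ _ (Real.log_pos one_lt_two).ne']
      calc Real.log L ≤ Real.log t := Real.log_le_log (by linarith) hLt'
        _ ≤ 0.6932 * Real.logb 2 t := by
            rw [hlogt, mul_comm]
            exact mul_le_mul_of_nonneg_right (Real.log_two_lt_d9.trans (by norm_num)).le (by linarith only [hΛ24])
    have hε : 2 * ((J : ℝ) + 1) * Real.exp (-(hh : ℝ)) ≤ 1 / (2 * t ^ 2) := by
      calc 2 * ((J : ℝ) + 1) * Real.exp (-(hh : ℝ)) ≤ 2 * (t / 4) * (1 / t ^ 3) := by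
            have := mul_le_mul hJ1 hexph (Real.exp_pos _).le (by positivity)
            linarith only [this]
        _ = 1 / (2 * t ^ 2) := by field_simp; ring
    have hNJr : ((2 : ℝ) ^ J) ≤ N := by exact_mod_cast hNJ
    have key := errorBound (M := (2 : ℝ) ^ J) (ε := 2 * ((J : ℝ) + 1) * Real.exp (-(hh : ℝ))) hK0 hd htr hΛ24 hLr hLt' htL hlg
      hLππ hNJr hJsq hN4 hε
    calc |h (∑ i, |x i|) - MvPolynomial.eval x P|
        ≤ |h (∑ i, |x i|) - g (∑ i, |x i|)| + |g (∑ i, |x i|) - MvPolynomial.eval x P| := abs_sub_le _ _ _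
      _ ≤ K * d * (1 / π + 1 + Real.log L) / L +
          (K * π * L / d * (d * π / 2 ^ J) ^ 2 + K * (d * π / N) +
            2 * ((J : ℝ) + 1) * Real.exp (-(hh : ℝ)) * (2 * L * (K * d)) * (1 + L * π / d * (d * π / 2 ^ J + d * π / N))) :=
          add_le_add h1 h2
      _ ≤ 8000 * K * d * Real.logb 2 t ^ 3 / t := key

/-- ★★★ **EVERY LIPSCHITZ LINK OF THE ℓ¹-NORM AT THE RIDGE RATE UP TO `log³` — ALL BUDGETS.**  For finite nonempty `ι` (`d = |ι|`), `K ≥ 0`,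
`h : ℝ → ℝ` with `|h(s) − h(s′)| ≤ K|s − s′|` on `[0, d]` and every `t ≥ 2` there is `P : MvPolynomial ι ℝ` of total degree `≤ t` with
**`|h(Σ_i|x_i|) − P(x)| ≤ 10⁴·K·d·(log₂t)³∕t`** on `[−1,1]^ι` (for `t ≥ 2^24` the previous theorem; below, the constant `h(0)`: `|h(S) − h(0)| ≤ Kd ≤
10⁴Kd·log₂³t∕t`).  READING (CURRENCY-MAP v11 (v′)): `sup_{h 1-Lip} dist_∞(h∘S_d, Π_t) ≲ d·log³t∕t` uniformly in `d` — the conjectured ridge rate up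
to `log³`, against the typed `d∕√t` (module 111) and the lower bound `d∕(π(9t+6))` (module 134); the `W₁` form (laws agreeing on `Π_t`) follows by
module 125's transfer (sequel). [folklore] -/
theorem exists_mvPolynomial_near_lipschitzLink_l1Norm {h : ℝ → ℝ} {K : ℝ} (hK0 : 0 ≤ K)
    (hK : ∀ s s', s ∈ Set.Icc (0 : ℝ) (Fintype.card ι) → s' ∈ Set.Icc (0 : ℝ) (Fintype.card ι) → |h s - h s'| ≤ K * |s - s'|)
    {t : ℕ} (ht : 2 ≤ t) :
    ∃ P : MvPolynomial ι ℝ, P.totalDegree ≤ t ∧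
      ∀ x : ι → ℝ, (∀ i, x i ∈ Set.Icc (-1 : ℝ) 1) →
        |h (∑ i, |x i|) - MvPolynomial.eval x P| ≤ 10000 * K * Fintype.card ι * Real.logb 2 t ^ 3 / t := by
  set d : ℝ := (Fintype.card ι : ℝ) with hdd
  have hd : 0 < d := by rw [hdd]; exact_mod_cast Fintype.card_pos
  have ht0 : (0 : ℝ) < t := by exact_mod_cast (show 0 < t by omega)
  have hKd : 0 ≤ K * d := mul_nonneg hK0 hd.le
  have hΛ1 : 1 ≤ Real.logb 2 t := by
    rw [Real.le_logb_iff_rpow_le one_lt_two ht0, Real.rpow_one]; exact_mod_cast ht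
  by_cases hbig : 2 ^ 24 ≤ t
  · obtain ⟨P, hP, herr⟩ := exists_mvPolynomial_near_lipschitzLink_l1Norm_of_le hK0 hK hbig
    refine ⟨P, hP, fun x hx => (herr x hx).trans ?_⟩
    rw [← hdd]
    exact div_le_div_of_nonneg_right (by nlinarith only [hKd, pow_pos (by linarith only [hΛ1] : (0 : ℝ) < Real.logb 2 t) 3]) ht0.le
  · -- small budgets: the constant `h(0)`
    have hsmall : (t : ℝ) ≤ 10000 * Real.logb 2 t ^ 3 := by
      by_cases h4 : t ≤ 10000
      · have h1 : (t : ℝ) ≤ 10000 := by exact_mod_cast h4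
        have h3 : (1 : ℝ) ≤ Real.logb 2 t ^ 3 := one_le_pow₀ hΛ1
        linarith only [h1, h3]
      · have h13 : (13 : ℝ) ≤ Real.logb 2 t := by
          rw [Real.le_logb_iff_rpow_le one_lt_two ht0, show (13 : ℝ) = ((13 : ℕ) : ℝ) by norm_num, Real.rpow_natCast]
          norm_num
          exact_mod_cast (show 8192 ≤ t by omega)
        have h2 : (t : ℝ) ≤ 16777216 := by exact_mod_cast (show t ≤ 2 ^ 24 by omega)
        have h3 := pow_le_pow_left₀ (by norm_num) h13 3
        linarith only [h3, h2]
    refine ⟨MvPolynomial.C (h 0), by rw [MvPolynomial.totalDegree_C]; exact Nat.zero_le _, fun x hx => ?_⟩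
    have hS := l1Norm_mem_Icc x hx
    rw [MvPolynomial.eval_C]
    calc |h (∑ i, |x i|) - h 0| ≤ K * |(∑ i, |x i|) - 0| := hK _ _ ⟨hS.1, hS.2⟩ ⟨le_rfl, Nat.cast_nonneg _⟩
      _ ≤ K * d := by
          refine mul_le_mul_of_nonneg_left ?_ hK0
          rw [sub_zero, abs_of_nonneg hS.1, hdd]; exact hS.2
      _ = K * d * 1 := (mul_one _).symm
      _ ≤ K * d * (10000 * Real.logb 2 t ^ 3 / t) := by
          refine mul_le_mul_of_nonneg_left ?_ hKd
          rw [le_div_iff₀ ht0, one_mul]; exact hsmall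
      _ = 10000 * K * Fintype.card ι * Real.logb 2 t ^ 3 / t := by rw [hdd]; ring

end Summit.QuantumFields.YangMills.Theorems.BalabanUVNodesN19LipschitzLinksDegreeBudget

end
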